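import Literature.Topology.FourManifolds.TwoKnotNormalSection
import HarnessLib

/-!
# The normal tube of a smooth embedding `S² ↪ S⁴`: normal projections, feet of normals, radius

Topic `Literature/Topology/FourManifolds`; second file of the decomposition of the named fact
`Literature.Topology.FourManifolds.TwoKnot.nonempty_normalFraming` (`FramedTubularNbhd.lean`: the normal bundle of a 2-knot is
trivial — Kirby, *The Topology of 4-Manifolds* (1989), Ch. VIII, Thm. 2, p. 44), after
`TwoKnotNormalSection.lean` (the orientation step). Kirby's proof of the remaining step — *the
normal bundle `ν` of `M = K(S²) ⊆ Q = S⁴` has a nowhere-zero section* — pulls `ν` back over a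
tubular neighbourhood `N` of `M`, where the tautological section trivialises it off `M`, and so
extends `ν` to a plane bundle `ξ` over `Q` (pp. 44–45). This file supplies the tubular
neighbourhood in the elementary form that construction needs (the sequel
`TwoKnotNormalEuler.lean` builds `ξ` and trivialises it along chords of `S⁴ ∖ pt`). Everything is
proved; there are no named facts. Throughout `f : 𝕊² → 𝕊⁴` is a smooth immersion (injective where
stated), `K̃ = ι ∘ f ∘ (y ↦ y/‖y‖) : ℝ³ → ℝ⁵` its radial extension (`Literature.Topology.FourManifolds.TwoKnotNormalSection.extF`)
and `DK̃(x) : ℝ³ →L ℝ⁵` its derivative (`dExt`), whose range at `x ∈ 𝕊²` is the tangent plane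
`df(T_x 𝕊²)`.

* **The normal projection as a smooth field of operators** (§ `SpanMap`, `OnSphere`): the span
  map `E_x u = ⟪x, u⟫ K̃(x) + DK̃(x) u` (`spanMap`; injective at `x ∈ 𝕊²` with range
  `ℝ f x ⊕ df(T_x 𝕊²)`), its formal adjoint and Gram operator (`spanMapAdj`, `gramOp`, invertible
  on the sphere), the projections `Π_x = E A⁻¹ Eᵀ` and `Q_x = 1 - Π_x` (`spanProj`, `norProj`).
  `Q_x` is the orthogonal projection of `ℝ⁵` onto the **normal plane**
  `ν_x = (ℝ f x ⊕ df(T_x 𝕊²))ᗮ ⊆ T_{f x} 𝕊⁴` (`norProj_eq_self_iff`, `norProj_norProj`,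
  `inner_norProj_comm`, `norm_norProj_le`), it is a `C^∞` function of `x`
  (`contMDiff_norProj`, by smoothness of operator inversion), `dim ν_x ≤ 2`
  (`finrank_ker_spanProj_le`) so that an orthonormal pair of normal vectors spans `ν_x`
  (`norProj_eq_sum_inner_smul`), and the partner vector of `TwoKnotNormalSection.lean` rotates
  `ν_x ∖ 0` into itself (`norProj_partnerVec`, `partnerVec_ne_zero_of_norProj_eq`).
* **Feet of normals and the injectivity radius** (§ `Tube`): the identities
  `⟪K̃, DK̃ u⟫ = 0` and `⟪DK̃ w, DK̃ u⟫ + ⟪K̃, D²K̃(w) u⟫ = 0` (`inner_extF_fderiv`,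
  `inner_fderiv_fderiv_add_inner_extF`), the immersion lower bound
  (`exists_mul_norm_le_norm_dExt`), and the **local uniqueness of the foot of a normal**
  (`exists_local_foot_unique`: the injectivity half of the inverse function theorem for the
  normal exponential map, proved by a direct second-order estimate), upgraded by compactness to a
  global **injectivity radius** for embeddings (`exists_injRadius`, `IsInjRadius`): a point of
  `ℝ⁵` within `ε` of two image points and normal to both tangent planes has equal feet. A nearest
  image point is the foot of a normal (`forall_inner_dExt_eq_zero_of_isMinOn`), so within the
  radius the nearest point `nearPt f z` is unique, equals `x` on `f x` (`IsInjRadius.nearPt_coe`),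
  and is **continuous on the tube** `{z | dist(z, f(𝕊²)) ≤ ε}` (`IsInjRadius.continuousOn_nearPt`:
  the inverse of the continuous bijection `(x, z) ↦ z` from the compact set of (foot, point)
  pairs).

This is Hirsch's tubular neighbourhood theorem (*Differential Topology* (1976), Ch. 4, §5,
Thm. 5.1: `(x, y) ↦ x + y` embeds a neighbourhood of the zero section of a field of transverse
planes) for the normal `3`-plane field `ℝ f x ⊕ ν_x = (df(T_x 𝕊²))ᗮ` of `f(𝕊²) ⊆ ℝ⁵`, in the
form "unique nearest point, depending continuously on the point", which is all the sequel uses;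
no manifold structure on the total space of `ν` is needed.

## References

* R. C. Kirby, *The Topology of 4-Manifolds*, LNM 1374, Springer (1989), Ch. VIII, Thm. 2 and its
  proof, pp. 44–45. [Kirby1989]
* M. W. Hirsch, *Differential Topology*, GTM 33, Springer (1976), Ch. 4, §5, Thm. 5.1 and
  Ch. 4, §2 (normal bundles of submanifolds of `ℝⁿ`). [HirschDT1976]

## Design notes

* All calculus is done in the flat space `ℝ³ ∖ 0 ⊇ 𝕊²` with the radial extension `K̃`
  (`Literature.Topology.FourManifolds.sphExt`), so that second derivatives are plain `fderiv`s; the link with `mfderiv` is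
  `Literature.Topology.FourManifolds.TwoKnotNormalSection.ambientDeriv_apply_eq`.
* The adjoint `E_xᵀ` is written in the standard basis (`∑ᵢ ⟪E eᵢ, ·⟫ eᵢ`) rather than with
  `ContinuousLinearMap.adjoint`, to keep the smoothness proof inside real-linear calculus.
* `nearPt` is a `Classical.epsilon` choice of a minimiser of `x ↦ ‖z - f x‖` (one exists for
  continuous `f`); its continuity is only claimed on the tube, within an injectivity radius.
-/

open scoped Manifold ContDiff Topology RealInnerProductSpace NNReal
open Set Function Metric Module Filter

noncomputable section

namespace Literature.Topology.FourManifolds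

/-- Local notation: `𝔼 n` is the model Euclidean space `EuclideanSpace ℝ (Fin n)`. -/
local notation "𝔼 " n:arg => EuclideanSpace ℝ (Fin n)

/-- Local notation: `𝕊 n` is the unit sphere in `EuclideanSpace ℝ (Fin (n + 1))`. -/
local notation "𝕊 " n:arg => (Metric.sphere (0 : EuclideanSpace ℝ (Fin (n + 1))) 1)

namespace TwoKnotNormalSection

/-! ### The span map `E_y` and its adjoint -/

section SpanMap

variable (f : 𝕊 2 → 𝕊 4)

/-- The **span map** `E_y : ℝ³ →L ℝ⁵`, `E_y u = ⟪y, u⟫ K̃(y) + DK̃(y) u` of the radial extension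
`K̃` of `ι ∘ f`: at a point `x ∈ 𝕊²` it is injective with range `ℝ (f x) ⊕ df(T_x 𝕊²)`, the
orthogonal complement of the normal plane of `f` at `x` inside `T_{f x} 𝕊⁴`. [folklore] -/
def spanMap (y : 𝔼 3) : 𝔼 3 →L[ℝ] 𝔼 5 :=
  (innerSL ℝ y).smulRight (extF f y) + fderiv ℝ (extF f) y

/-- Unfolding of the span map. [folklore] -/
theorem spanMap_apply (y u : 𝔼 3) :
    spanMap f y u = ⟪y, u⟫ • extF f y + fderiv ℝ (extF f) y u := by
  simp [spanMap]

/-- The **formal adjoint** `E_yᵀ : ℝ⁵ →L ℝ³` of the span map, written in the standard basis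
(`E_yᵀ z = ∑ᵢ ⟪E_y eᵢ, z⟫ eᵢ`). [folklore] -/
def spanMapAdj (y : 𝔼 3) : 𝔼 5 →L[ℝ] 𝔼 3 :=
  ∑ i : Fin 3, (innerSL ℝ (spanMap f y (EuclideanSpace.single i 1))).smulRight
    (EuclideanSpace.single i (1 : ℝ))

/-- Unfolding of the adjoint span map. [folklore] -/
theorem spanMapAdj_apply (y : 𝔼 3) (z : 𝔼 5) :
    spanMapAdj f y z = ∑ i : Fin 3, ⟪spanMap f y (EuclideanSpace.single i 1), z⟫ •
      EuclideanSpace.single i (1 : ℝ) := by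
  simp [spanMapAdj]

/-- **Adjointness**: `⟪E_yᵀ z, u⟫ = ⟪z, E_y u⟫`. [folklore] -/
theorem inner_spanMapAdj (y : 𝔼 3) (z : 𝔼 5) (u : 𝔼 3) :
    ⟪spanMapAdj f y z, u⟫ = ⟪z, spanMap f y u⟫ := by
  rw [spanMapAdj_apply, sum_inner]
  conv_rhs => rw [← (EuclideanSpace.basisFun (Fin 3) ℝ).sum_repr u]
  simp only [EuclideanSpace.basisFun_repr, EuclideanSpace.basisFun_apply, map_sum, map_smul,
    inner_sum, inner_smul_right, inner_smul_left, EuclideanSpace.inner_single_left, map_one,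
    one_mul, RCLike.conj_to_real]
  refine Finset.sum_congr rfl fun i _ => ?_
  rw [real_inner_comm z]
  ring

/-- `⟪E_y u, z⟫ = ⟪u, E_yᵀ z⟫`. [folklore] -/
theorem inner_spanMap_left (y : 𝔼 3) (u : 𝔼 3) (z : 𝔼 5) :
    ⟪spanMap f y u, z⟫ = ⟪u, spanMapAdj f y z⟫ := by
  rw [real_inner_comm, ← inner_spanMapAdj, real_inner_comm]

/-- The **Gram operator** `A_y = E_yᵀ E_y : ℝ³ →L ℝ³`. [folklore] -/
def gramOp (y : 𝔼 3) : 𝔼 3 →L[ℝ] 𝔼 3 := (spanMapAdj f y).comp (spanMap f y)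

/-- Unfolding of the Gram operator. [folklore] -/
theorem gramOp_apply (y u : 𝔼 3) : gramOp f y u = spanMapAdj f y (spanMap f y u) := rfl

/-- `⟪A_y u, v⟫ = ⟪E_y u, E_y v⟫`. [folklore] -/
theorem inner_gramOp (y u v : 𝔼 3) : ⟪gramOp f y u, v⟫ = ⟪spanMap f y u, spanMap f y v⟫ := by
  rw [gramOp_apply, inner_spanMapAdj]

/-- The Gram operator is symmetric. [folklore] -/
theorem inner_gramOp_comm (y u v : 𝔼 3) : ⟪gramOp f y u, v⟫ = ⟪u, gramOp f y v⟫ := by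
  rw [inner_gramOp, real_inner_comm (gramOp f y v) u, inner_gramOp, real_inner_comm]

/-- The **span projection** `Π_y = E_y A_y⁻¹ E_yᵀ` (orthogonal projection onto the range of `E_y`
when `E_y` is injective; `ContinuousLinearMap.inverse` is the junk-free inverse, `0` when `A_y`
is not invertible). [folklore] -/
def spanProj (y : 𝔼 3) : 𝔼 5 →L[ℝ] 𝔼 5 :=
  (spanMap f y).comp ((ContinuousLinearMap.inverse (gramOp f y)).comp (spanMapAdj f y))

/-- Unfolding of the span projection. [folklore] -/
theorem spanProj_apply (y : 𝔼 3) (z : 𝔼 5) :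
    spanProj f y z = spanMap f y ((gramOp f y).inverse (spanMapAdj f y z)) := rfl

/-- The **normal projection** `Q_y = 1 - Π_y`: at `x ∈ 𝕊²`, the orthogonal projection of `ℝ⁵`
onto the normal plane `ν_x = (ℝ (f x) ⊕ df(T_x 𝕊²))ᗮ` of `f` at `x` inside `T_{f x} 𝕊⁴`.
[folklore] -/
def norProj (y : 𝔼 3) : 𝔼 5 →L[ℝ] 𝔼 5 := ContinuousLinearMap.id ℝ (𝔼 5) - spanProj f y

/-- Unfolding of the normal projection. [folklore] -/
theorem norProj_apply (y : 𝔼 3) (z : 𝔼 5) : norProj f y z = z - spanProj f y z := rfl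

/-! #### Smoothness off the origin -/

variable {f}

/-- The span map is smooth off the origin. [folklore] -/
theorem contDiffAt_spanMap (hf : ContMDiff (𝓡 2) (𝓡 4) ∞ f) {y : 𝔼 3} (hy : y ≠ 0) :
    ContDiffAt ℝ ∞ (spanMap f) y :=
  ((innerSL ℝ (E := 𝔼 3)).contDiff.contDiffAt.smulRight
    (contDiffAt_sphExt (contMDiff_coe_comp hf) hy)).add
    (contDiffAt_fderiv_sphExt (contMDiff_coe_comp hf) hy)

/-- The adjoint span map is smooth off the origin. [folklore] -/
theorem contDiffAt_spanMapAdj (hf : ContMDiff (𝓡 2) (𝓡 4) ∞ f) {y : 𝔼 3} (hy : y ≠ 0) :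
    ContDiffAt ℝ ∞ (spanMapAdj f) y := by
  unfold spanMapAdj
  refine ContDiffAt.sum fun i _ => ?_
  exact ((innerSL ℝ (E := 𝔼 5)).contDiff.contDiffAt.comp y
    ((contDiffAt_spanMap hf hy).clm_apply contDiffAt_const)).smulRight contDiffAt_const

/-- The Gram operator is smooth off the origin. [folklore] -/
theorem contDiffAt_gramOp (hf : ContMDiff (𝓡 2) (𝓡 4) ∞ f) {y : 𝔼 3} (hy : y ≠ 0) :
    ContDiffAt ℝ ∞ (gramOp f) y :=
  (contDiffAt_spanMapAdj hf hy).clm_comp (contDiffAt_spanMap hf hy)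

/-- The span projection is smooth at every point off the origin where the Gram operator is
invertible (inversion of operators is smooth). [folklore] -/
theorem contDiffAt_spanProj (hf : ContMDiff (𝓡 2) (𝓡 4) ∞ f) {y : 𝔼 3} (hy : y ≠ 0)
    (hA : (gramOp f y).IsInvertible) : ContDiffAt ℝ ∞ (spanProj f) y :=
  (contDiffAt_spanMap hf hy).clm_comp
    ((hA.contDiffAt_map_inverse.comp y (contDiffAt_gramOp hf hy)).clm_comp
      (contDiffAt_spanMapAdj hf hy))

/-- The normal projection is smooth at every point off the origin where the Gram operator is
invertible. [folklore] -/
theorem contDiffAt_norProj (hf : ContMDiff (𝓡 2) (𝓡 4) ∞ f) {y : 𝔼 3} (hy : y ≠ 0)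
    (hA : (gramOp f y).IsInvertible) : ContDiffAt ℝ ∞ (norProj f) y :=
  contDiffAt_const.sub (contDiffAt_spanProj hf hy hA)

end SpanMap

/-! ### On the sphere: injectivity, the projections, the normal plane -/

section OnSphere

variable {f : 𝕊 2 → 𝕊 4}

/-- `DK̃(x) u ⊥ f x` (the tangent plane of `f` lies in `T_{f x} 𝕊⁴ = (f x)ᗮ`). [folklore] -/
theorem inner_dExt_coe (hf : ContMDiff (𝓡 2) (𝓡 4) ∞ f) (x : 𝕊 2) (u : 𝔼 3) :
    ⟪dExt f x u, (f x : 𝔼 5)⟫ = 0 := by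
  obtain ⟨v, hv⟩ := dExt_apply_mem_range hf x u
  rw [← hv]
  exact inner_ambientDeriv_eq_zero hf x v

/-- `DK̃(x)` is injective on `xᗮ` (immersion). [folklore] -/
theorem dExt_eq_zero_imp (hf : ContMDiff (𝓡 2) (𝓡 4) ∞ f)
    (hf' : ∀ x, Injective (mfderiv (𝓡 2) (𝓡 4) f x)) (x : 𝕊 2) {u : 𝔼 3}
    (hu : ⟪u, (x : 𝔼 3)⟫ = 0) (h : dExt f x u = 0) : u = 0 := by
  obtain ⟨v, hv⟩ := exists_mfderiv_coe_eq x hu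
  rw [← hv, ← ambientDeriv_apply_eq hf] at h
  have hv0 : v = 0 := (injective_iff_map_eq_zero _).1 (injective_ambientDeriv hf hf' x) _ h
  rw [← hv, hv0]
  exact (mfderiv (𝓡 2) 𝓘(ℝ, 𝔼 3) (Subtype.val : 𝕊 2 → 𝔼 3) x).map_zero

/-- On the sphere, `E_x u = ⟪x, u⟫ f x + DK̃(x) u`. [folklore] -/
theorem spanMap_coe_apply (x : 𝕊 2) (u : 𝔼 3) :
    spanMap f x u = ⟪(x : 𝔼 3), u⟫ • (f x : 𝔼 5) + dExt f x u := by
  rw [spanMap_apply, extF, sphExt_coe]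
  rfl

/-- `E_x x = f x`. [folklore] -/
theorem spanMap_coe_apply_self (hf : ContMDiff (𝓡 2) (𝓡 4) ∞ f) (x : 𝕊 2) :
    spanMap f x x = f x := by
  rw [spanMap_coe_apply, dExt_apply_self hf, add_zero, real_inner_self_eq_norm_sq,
    norm_eq_of_mem_sphere, one_pow, one_smul]

/-- `⟪E_x u, f x⟫ = ⟪x, u⟫`. [folklore] -/
theorem inner_spanMap_coe (hf : ContMDiff (𝓡 2) (𝓡 4) ∞ f) (x : 𝕊 2) (u : 𝔼 3) :
    ⟪spanMap f x u, (f x : 𝔼 5)⟫ = ⟪(x : 𝔼 3), u⟫ := by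
  rw [spanMap_coe_apply, inner_add_left, inner_smul_left, inner_dExt_coe hf,
    real_inner_self_eq_norm_sq, norm_eq_of_mem_sphere]
  simp

/-- `DK̃(x) u = E_x u - ⟪x, u⟫ E_x x`. [folklore] -/
theorem dExt_eq_spanMap_sub (hf : ContMDiff (𝓡 2) (𝓡 4) ∞ f) (x : 𝕊 2) (u : 𝔼 3) :
    dExt f x u = spanMap f x u - ⟪(x : 𝔼 3), u⟫ • spanMap f x x := by
  rw [spanMap_coe_apply_self hf, spanMap_coe_apply]
  abel

/-- **The span map is injective at points of the sphere** (`‖f x‖ = 1`, tangency, immersion).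
[folklore] -/
theorem injective_spanMap (hf : ContMDiff (𝓡 2) (𝓡 4) ∞ f)
    (hf' : ∀ x, Injective (mfderiv (𝓡 2) (𝓡 4) f x)) (x : 𝕊 2) :
    Injective (spanMap f x) := by
  refine (injective_iff_map_eq_zero _).2 fun u hu => ?_
  have h1 : ⟪(x : 𝔼 3), u⟫ = 0 := by rw [← inner_spanMap_coe hf x u, hu, inner_zero_left]
  have h2 : dExt f x u = 0 := by
    have := spanMap_coe_apply (f := f) x u
    rwa [hu, h1, zero_smul, zero_add, eq_comm] at this
  exact dExt_eq_zero_imp hf hf' x (by rw [real_inner_comm]; exact h1) h2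

/-- **The Gram operator is invertible at points of the sphere.** [folklore] -/
theorem isInvertible_gramOp (hf : ContMDiff (𝓡 2) (𝓡 4) ∞ f)
    (hf' : ∀ x, Injective (mfderiv (𝓡 2) (𝓡 4) f x)) (x : 𝕊 2) :
    (gramOp f x).IsInvertible := by
  have hinj : Injective (gramOp f x) := by
    refine (injective_iff_map_eq_zero _).2 fun u hu => ?_
    have h : ⟪spanMap f x u, spanMap f x u⟫ = 0 := by rw [← inner_gramOp, hu, inner_zero_left]
    exact (injective_iff_map_eq_zero _).1 (injective_spanMap hf hf' x) u
      (inner_self_eq_zero.1 h)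
  let e : 𝔼 3 ≃L[ℝ] 𝔼 3 :=
    (LinearEquiv.ofInjectiveEndo (gramOp f x).toLinearMap hinj).toContinuousLinearEquiv
  refine ⟨e, ?_⟩
  ext1 u
  rfl

/-- **The normal projection, restricted to the sphere, is a smooth field of operators.**
[folklore] -/
theorem contMDiff_norProj (hf : ContMDiff (𝓡 2) (𝓡 4) ∞ f)
    (hf' : ∀ x, Injective (mfderiv (𝓡 2) (𝓡 4) f x)) :
    ContMDiff (𝓡 2) 𝓘(ℝ, 𝔼 5 →L[ℝ] 𝔼 5) ∞ fun x : 𝕊 2 => norProj f x :=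
  haveI := Fact.mk (@finrank_euclideanSpace_fin ℝ _ (2 + 1))
  fun x => (contDiffAt_norProj hf (ne_zero_of_mem_unit_sphere x)
    (isInvertible_gramOp hf hf' x)).comp_contMDiffAt (contMDiff_coe_sphere x)

/-- The normal projection, restricted to the sphere, is continuous. [folklore] -/
theorem continuous_norProj (hf : ContMDiff (𝓡 2) (𝓡 4) ∞ f)
    (hf' : ∀ x, Injective (mfderiv (𝓡 2) (𝓡 4) f x)) :
    Continuous fun x : 𝕊 2 => norProj f x :=
  (contMDiff_norProj hf hf').continuous

section Algebra

variable (hf : ContMDiff (𝓡 2) (𝓡 4) ∞ f) (hf' : ∀ x, Injective (mfderiv (𝓡 2) (𝓡 4) f x))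
  (x : 𝕊 2)
include hf hf'

/-- `A_x A_x⁻¹ = 1`. [folklore] -/
theorem gramOp_inverse_apply (v : 𝔼 3) : gramOp f x ((gramOp f x).inverse v) = v :=
  (isInvertible_gramOp hf hf' x).self_apply_inverse v

/-- `A_x⁻¹ A_x = 1`. [folklore] -/
theorem inverse_gramOp_apply (u : 𝔼 3) : (gramOp f x).inverse (gramOp f x u) = u :=
  (isInvertible_gramOp hf hf' x).inverse_apply_self u

/-- `A_x⁻¹` is symmetric. [folklore] -/
theorem inner_inverse_gramOp_comm (p q : 𝔼 3) :
    ⟪(gramOp f x).inverse p, q⟫ = ⟪p, (gramOp f x).inverse q⟫ := by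
  conv_lhs => rw [← gramOp_inverse_apply hf hf' x q]
  rw [← inner_gramOp_comm, gramOp_inverse_apply hf hf' x p]

/-- `Π_x E_x = E_x`. [folklore] -/
theorem spanProj_spanMap (u : 𝔼 3) : spanProj f x (spanMap f x u) = spanMap f x u := by
  rw [spanProj_apply, ← gramOp_apply, inverse_gramOp_apply hf hf' x]

/-- `Π_x (f x) = f x`. [folklore] -/
theorem spanProj_coe : spanProj f x (f x) = f x := by
  rw [← spanMap_coe_apply_self hf x, spanProj_spanMap hf hf' x]

/-- `Π_x (DK̃(x) u) = DK̃(x) u`. [folklore] -/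
theorem spanProj_dExt (u : 𝔼 3) : spanProj f x (dExt f x u) = dExt f x u := by
  rw [dExt_eq_spanMap_sub hf x u, map_sub, map_smul, spanProj_spanMap hf hf' x,
    spanProj_spanMap hf hf' x]

/-- `E_xᵀ Π_x = E_xᵀ`. [folklore] -/
theorem spanMapAdj_spanProj (z : 𝔼 5) : spanMapAdj f x (spanProj f x z) = spanMapAdj f x z := by
  rw [spanProj_apply, ← gramOp_apply, gramOp_inverse_apply hf hf' x]

/-- `Π_x` is idempotent. [folklore] -/
theorem spanProj_spanProj (z : 𝔼 5) : spanProj f x (spanProj f x z) = spanProj f x z := by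
  conv_lhs => rw [spanProj_apply, spanMapAdj_spanProj hf hf' x, ← spanProj_apply]

/-- `Π_x` is symmetric. [folklore] -/
theorem inner_spanProj_comm (z w : 𝔼 5) : ⟪spanProj f x z, w⟫ = ⟪z, spanProj f x w⟫ := by
  rw [spanProj_apply, spanProj_apply, inner_spanMap_left, inner_inverse_gramOp_comm hf hf' x,
    ← inner_spanMapAdj]

/-- `Π_x z = 0 ↔ E_xᵀ z = 0`. [folklore] -/
theorem spanProj_eq_zero_iff (z : 𝔼 5) : spanProj f x z = 0 ↔ spanMapAdj f x z = 0 := by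
  constructor
  · intro h
    rw [← spanMapAdj_spanProj hf hf' x, h, map_zero]
  · intro h
    rw [spanProj_apply, h, map_zero, map_zero]

omit hf hf' in
/-- `E_xᵀ z = 0 ↔ z ⊥ range E_x`. [folklore] -/
theorem spanMapAdj_eq_zero_iff (z : 𝔼 5) :
    spanMapAdj f x z = 0 ↔ ∀ u, ⟪z, spanMap f x u⟫ = 0 := by
  constructor
  · intro h u
    rw [← inner_spanMapAdj, h, inner_zero_left]
  · intro h
    refine ext_inner_right ℝ fun u => ?_
    rw [inner_spanMapAdj, h, inner_zero_left]

omit hf' in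
/-- `z ⊥ range E_x ↔ (z ⊥ f x ∧ z ⊥ df(T_x 𝕊²))`. [folklore] -/
theorem forall_inner_spanMap_eq_zero_iff (z : 𝔼 5) :
    (∀ u, ⟪z, spanMap f x u⟫ = 0) ↔ (⟪z, (f x : 𝔼 5)⟫ = 0 ∧ ∀ u, ⟪z, dExt f x u⟫ = 0) := by
  constructor
  · intro h
    have h0 : ⟪z, (f x : 𝔼 5)⟫ = 0 := by rw [← spanMap_coe_apply_self hf x]; exact h x
    refine ⟨h0, fun u => ?_⟩
    rw [dExt_eq_spanMap_sub hf x u, inner_sub_right, inner_smul_right, h, h, mul_zero, sub_zero]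
  · rintro ⟨h0, h1⟩ u
    rw [spanMap_coe_apply, inner_add_right, inner_smul_right, h0, h1, mul_zero, add_zero]

/-- **Fixed vectors of the normal projection are exactly the normal vectors**:
`Q_x z = z ↔ (z ⊥ f x ∧ z ⊥ df(T_x 𝕊²))`. [folklore] -/
theorem norProj_eq_self_iff (z : 𝔼 5) :
    norProj f x z = z ↔ (⟪z, (f x : 𝔼 5)⟫ = 0 ∧ ∀ u, ⟪z, dExt f x u⟫ = 0) := by
  rw [norProj_apply, sub_eq_self, spanProj_eq_zero_iff hf hf' x, spanMapAdj_eq_zero_iff,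
    forall_inner_spanMap_eq_zero_iff hf x]

/-- `Q_x E_x = 0`. [folklore] -/
theorem norProj_spanMap (u : 𝔼 3) : norProj f x (spanMap f x u) = 0 := by
  rw [norProj_apply, spanProj_spanMap hf hf' x, sub_self]

/-- `Q_x (f x) = 0`. [folklore] -/
theorem norProj_coe : norProj f x (f x) = 0 := by
  rw [norProj_apply, spanProj_coe hf hf' x, sub_self]

/-- `Q_x (DK̃(x) u) = 0`: the normal projection kills the tangent plane. [folklore] -/
theorem norProj_dExt (u : 𝔼 3) : norProj f x (dExt f x u) = 0 := by
  rw [norProj_apply, spanProj_dExt hf hf' x, sub_self]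

/-- `Q_x` kills the ambient differential `d(ι ∘ f)(T_x 𝕊²)`. [folklore] -/
theorem norProj_ambientDeriv (v : TangentSpace (𝓡 2) x) :
    norProj f x (ambientDeriv (𝓡 2) f x v) = 0 := by
  rw [ambientDeriv_apply_eq hf, norProj_dExt hf hf' x]

/-- `Q_x` is idempotent. [folklore] -/
theorem norProj_norProj (z : 𝔼 5) : norProj f x (norProj f x z) = norProj f x z := by
  simp only [norProj_apply, map_sub, spanProj_spanProj hf hf' x, sub_self, sub_zero]

/-- `Q_x` is idempotent (operator form). [folklore] -/
theorem norProj_comp_norProj : (norProj f x).comp (norProj f x) = norProj f x :=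
  ContinuousLinearMap.ext (norProj_norProj hf hf' x)

/-- `Q_x` is symmetric. [folklore] -/
theorem inner_norProj_comm (z w : 𝔼 5) : ⟪norProj f x z, w⟫ = ⟪z, norProj f x w⟫ := by
  simp only [norProj_apply, inner_sub_left, inner_sub_right, inner_spanProj_comm hf hf' x]

/-- `Q_x z ⊥ f x`. [folklore] -/
theorem inner_norProj_coe (z : 𝔼 5) : ⟪norProj f x z, (f x : 𝔼 5)⟫ = 0 :=
  ((norProj_eq_self_iff hf hf' x _).1 (norProj_norProj hf hf' x z)).1

/-- `Q_x z ⊥ DK̃(x) u`. [folklore] -/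
theorem inner_norProj_dExt (z : 𝔼 5) (u : 𝔼 3) : ⟪norProj f x z, dExt f x u⟫ = 0 :=
  ((norProj_eq_self_iff hf hf' x _).1 (norProj_norProj hf hf' x z)).2 u

/-- `‖Q_x z‖² = ⟪z, Q_x z⟫`. [folklore] -/
theorem norm_norProj_sq (z : 𝔼 5) : ‖norProj f x z‖ ^ 2 = ⟪z, norProj f x z⟫ := by
  rw [← real_inner_self_eq_norm_sq, inner_norProj_comm hf hf' x, norProj_norProj hf hf' x]

/-- `‖Q_x z‖ ≤ ‖z‖` (an orthogonal projection does not increase norms). [folklore] -/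
theorem norm_norProj_le (z : 𝔼 5) : ‖norProj f x z‖ ≤ ‖z‖ := by
  have h := norm_norProj_sq hf hf' x z
  have h2 : ⟪z, norProj f x z⟫ ≤ ‖z‖ * ‖norProj f x z‖ := real_inner_le_norm _ _
  nlinarith [norm_nonneg (norProj f x z), norm_nonneg z]

/-- For a vector `z` orthogonal to the tangent plane, `Q_x z = z - ⟪z, f x⟫ f x`. [folklore] -/
theorem norProj_eq_sub_of_forall_inner_dExt (z : 𝔼 5) (hz : ∀ u, ⟪z, dExt f x u⟫ = 0) :
    norProj f x z = z - ⟪z, (f x : 𝔼 5)⟫ • (f x : 𝔼 5) := by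
  have hfix : norProj f x (z - ⟪z, (f x : 𝔼 5)⟫ • (f x : 𝔼 5)) =
      z - ⟪z, (f x : 𝔼 5)⟫ • (f x : 𝔼 5) := by
    refine (norProj_eq_self_iff hf hf' x _).2 ⟨?_, fun u => ?_⟩
    · rw [inner_sub_left, inner_smul_left, real_inner_self_eq_norm_sq, norm_eq_of_mem_sphere]
      simp
    · rw [inner_sub_left, inner_smul_left, hz, real_inner_comm (dExt f x u) (f x : 𝔼 5),
        inner_dExt_coe hf]
      simp
  have : z = (z - ⟪z, (f x : 𝔼 5)⟫ • (f x : 𝔼 5)) + ⟪z, (f x : 𝔼 5)⟫ • (f x : 𝔼 5) := by abel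
  conv_lhs => rw [this, map_add, map_smul, norProj_coe hf hf' x, smul_zero, add_zero, hfix]

/-- The normal plane has dimension at most `2`: the kernel of `Π_x` has `finrank ≤ 2` (the range of
`Π_x` contains the `3`-dimensional range of the injective `E_x`). [folklore] -/
theorem finrank_ker_spanProj_le :
    finrank ℝ (LinearMap.ker (spanProj f x).toLinearMap) ≤ 2 := by
  haveI := Fact.mk (@finrank_euclideanSpace_fin ℝ _ 5)
  have hE : finrank ℝ (LinearMap.range (spanMap f x).toLinearMap) = 3 := by
    rw [LinearMap.finrank_range_of_inj (injective_spanMap hf hf' x), finrank_euclideanSpace_fin]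
  have hle : LinearMap.range (spanMap f x).toLinearMap ≤
      LinearMap.range (spanProj f x).toLinearMap := by
    rintro _ ⟨u, rfl⟩
    exact ⟨spanMap f x u, spanProj_spanMap hf hf' x u⟩
  have h3 : 3 ≤ finrank ℝ (LinearMap.range (spanProj f x).toLinearMap) := by
    rw [← hE]; exact Submodule.finrank_mono hle
  have hsum := LinearMap.finrank_range_add_finrank_ker (spanProj f x).toLinearMap
  rw [finrank_euclideanSpace_fin] at hsum
  omega

/-- **An orthonormal pair of normal vectors spans the normal plane**: if `u₀, u₁` are orthonormal
and fixed by `Q_x` then `Q_x p = ⟪u₀, p⟫ u₀ + ⟪u₁, p⟫ u₁` for every `p`. [folklore] -/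
theorem norProj_eq_sum_inner_smul {u : Fin 2 → 𝔼 5} (hu : Orthonormal ℝ u)
    (hQu : ∀ i, norProj f x (u i) = u i) (p : 𝔼 5) :
    norProj f x p = ∑ i, ⟪u i, p⟫ • u i := by
  set p' := norProj f x p - ∑ i, ⟪u i, p⟫ • u i with hp'
  -- `p'` is a normal vector orthogonal to `u 0, u 1`
  have hQp' : norProj f x p' = p' := by
    simp only [hp', map_sub, map_sum, map_smul, norProj_norProj hf hf' x, hQu]
  have hp'u : ∀ j, ⟪p', u j⟫ = 0 := by
    intro j
    simp only [hp', inner_sub_left, sum_inner, inner_smul_left, inner_norProj_comm hf hf' x, hQu,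
      orthonormal_iff_ite.1 hu, RCLike.conj_to_real]
    rw [real_inner_comm]
    simp
  -- if `p' ≠ 0`, the three vectors `u 0, u 1, p'` are independent normal vectors: too many
  by_contra hne
  have hp'0 : p' ≠ 0 := fun h => hne (sub_eq_zero.1 (hp' ▸ h))
  let w : Fin 3 → 𝔼 5 := ![u 0, u 1, p']
  have hw0 : ∀ i, w i ≠ 0 := by
    intro i
    fin_cases i
    · exact hu.ne_zero 0
    · exact hu.ne_zero 1
    · exact hp'0
  have hwo : Pairwise fun i j => ⟪w i, w j⟫ = 0 := by
    intro i j hij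
    fin_cases i <;> fin_cases j <;> first
      | exact absurd rfl hij
      | simp [w, orthonormal_iff_ite.1 hu, hp'u, real_inner_comm p']
  have hli : LinearIndependent ℝ w := linearIndependent_of_ne_zero_of_inner_eq_zero hw0 hwo
  -- all three lie in `ker Π_x`
  have h2 := finrank_ker_spanProj_le hf hf' x
  set W := LinearMap.ker (spanProj f x).toLinearMap
  have hmem : ∀ i, w i ∈ W := by
    have hker : ∀ z, norProj f x z = z → z ∈ W := fun z hz => by
      rw [norProj_apply, sub_eq_self] at hz
      exact hz
    intro i
    fin_cases i
    · exact hker _ (hQu 0)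
    · exact hker _ (hQu 1)
    · exact hker _ hQp'
  let w' : Fin 3 → W := fun i => ⟨w i, hmem i⟩
  have hli' : LinearIndependent ℝ w' :=
    LinearIndependent.of_comp W.subtype (by simpa [w', Function.comp_def] using hli)
  have := hli'.fintype_card_le_finrank
  simp only [Fintype.card_fin] at this
  omega

/-! #### The rotated normal vector -/

omit hf hf' in
/-- The partner vector of a normal vector is orthogonal to `f x`. [folklore] -/
theorem inner_partnerVec_coe (v : 𝔼 5) :
    ⟪partnerVec (f x : 𝔼 5) v (dExt f x) (x : 𝔼 3), (f x : 𝔼 5)⟫ = 0 :=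
  inner_partnerField_eq_zero (s := fun (_ : Fin 1) (_ : 𝕊 2) => v) x

omit hf hf' in
/-- The partner vector of `v` is orthogonal to `v`. [folklore] -/
theorem inner_partnerVec_self (v : 𝔼 5) :
    ⟪partnerVec (f x : 𝔼 5) v (dExt f x) (x : 𝔼 3), v⟫ = 0 :=
  inner_partnerField_apply_eq_zero (s := fun (_ : Fin 1) (_ : 𝕊 2) => v) x

omit hf' in
/-- The partner vector is orthogonal to the tangent plane. [folklore] -/
theorem inner_partnerVec_dExt (v : 𝔼 5) (u : 𝔼 3) :
    ⟪partnerVec (f x : 𝔼 5) v (dExt f x) (x : 𝔼 3), dExt f x u⟫ = 0 := by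
  obtain ⟨w, hw⟩ := dExt_apply_mem_range hf x u
  rw [← hw]
  exact inner_partnerField_ambientDeriv (s := fun (_ : Fin 1) (_ : 𝕊 2) => v) hf x w

/-- The partner vector is a normal vector: it is fixed by `Q_x`. [folklore] -/
theorem norProj_partnerVec (v : 𝔼 5) :
    norProj f x (partnerVec (f x : 𝔼 5) v (dExt f x) (x : 𝔼 3)) =
      partnerVec (f x : 𝔼 5) v (dExt f x) (x : 𝔼 3) :=
  (norProj_eq_self_iff hf hf' x _).2
    ⟨inner_partnerVec_coe x v, inner_partnerVec_dExt hf x v⟩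

/-- **The partner vector of a nonzero normal vector is nonzero** (`Q_x v = v`, `v ≠ 0`).
[cite: Kirby1989, Ch. VIII, proof of Thm. 2, p. 44] -/
theorem partnerVec_ne_zero_of_norProj_eq {v : 𝔼 5} (hv : norProj f x v = v) (hv0 : v ≠ 0) :
    partnerVec (f x : 𝔼 5) v (dExt f x) (x : 𝔼 3) ≠ 0 :=
  have h := (norProj_eq_self_iff hf hf' x v).1 hv
  partnerVec_ne_zero_of_inner_eq_zero hf hf' x hv0 h.1 h.2

end Algebra

end OnSphere

section Tube

variable {f : 𝕊 2 → 𝕊 4}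

/-! ### Calculus of the radial extension `K̃` of `ι ∘ f` -/

/-- `‖K̃(y)‖ = 1` everywhere (`K̃` takes values on `f(𝕊²) ⊆ 𝕊⁴`). [folklore] -/
theorem norm_extF (y : 𝔼 3) : ‖extF f y‖ = 1 := norm_eq_of_mem_sphere (f _)

/-- `K̃(y) ∈ f(𝕊²)` everywhere. [folklore] -/
theorem extF_mem_range (y : 𝔼 3) : extF f y ∈ range fun x : 𝕊 2 => (f x : 𝔼 5) := ⟨_, rfl⟩

/-- **First-order identity** `⟪K̃(y), DK̃(y) u⟫ = 0` off the origin (differentiate `‖K̃‖² = 1`).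
[folklore] -/
theorem inner_extF_fderiv (hf : ContMDiff (𝓡 2) (𝓡 4) ∞ f) {y : 𝔼 3} (hy : y ≠ 0) (u : 𝔼 3) :
    ⟪extF f y, fderiv ℝ (extF f) y u⟫ = 0 := by
  have hK : HasFDerivAt (extF f) (fderiv ℝ (extF f) y) y :=
    hasFDerivAt_sphExt (contMDiff_coe_comp hf) hy
  have h1 := hK.inner ℝ hK
  have h2 : HasFDerivAt (fun t => ⟪extF f t, extF f t⟫) (0 : 𝔼 3 →L[ℝ] ℝ) y := by
    have : (fun t => ⟪extF f t, extF f t⟫) = fun _ => (1 : ℝ) := by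
      funext t
      rw [real_inner_self_eq_norm_sq, norm_extF, one_pow]
    rw [this]
    exact hasFDerivAt_const 1 y
  have h := congrArg (fun L => L u) (h1.unique h2)
  simp only [ContinuousLinearMap.comp_apply, ContinuousLinearMap.prod_apply, fderivInnerCLM_apply,
    zero_apply] at h
  rw [real_inner_comm (extF f y)] at h
  linarith

/-- **Second-order identity** `⟪DK̃(y) w, DK̃(y) u⟫ + ⟪K̃(y), D²K̃(y)(w) u⟫ = 0` off the origin
(differentiate the first-order identity). [folklore] -/
theorem inner_fderiv_fderiv_add_inner_extF (hf : ContMDiff (𝓡 2) (𝓡 4) ∞ f) {y : 𝔼 3}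
    (hy : y ≠ 0) (u w : 𝔼 3) :
    ⟪fderiv ℝ (extF f) y w, fderiv ℝ (extF f) y u⟫ +
      ⟪extF f y, (fderiv ℝ (fun t => fderiv ℝ (extF f) t) y w) u⟫ = 0 := by
  have hfE := contMDiff_coe_comp hf
  set G : 𝔼 3 → 𝔼 3 →L[ℝ] 𝔼 5 := fun t => fderiv ℝ (extF f) t with hG
  -- the function `t ↦ ⟪K̃ t, G t u⟫` vanishes near `y`
  have hφ0 : (fun t => ⟪extF f t, G t u⟫) =ᶠ[𝓝 y] fun _ => (0 : ℝ) := by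
    filter_upwards [isOpen_ne.mem_nhds hy] with t ht
    exact inner_extF_fderiv hf ht u
  have hD1 : HasFDerivAt (fun t => ⟪extF f t, G t u⟫) (0 : 𝔼 3 →L[ℝ] ℝ) y :=
    (hasFDerivAt_const (0 : ℝ) y).congr_of_eventuallyEq hφ0
  have hGd : HasFDerivAt G (fderiv ℝ G y) y :=
    ((contDiffAt_fderiv_sphExt hfE hy).differentiableAt (by simp)).hasFDerivAt
  have hGu : HasFDerivAt (fun t => G t u) ((G y).comp (0 : 𝔼 3 →L[ℝ] 𝔼 3) +
      (fderiv ℝ G y).flip u) y := hGd.clm_apply (hasFDerivAt_const u y)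
  have hK : HasFDerivAt (extF f) (G y) y := hasFDerivAt_sphExt hfE hy
  have hD2 := hK.inner ℝ hGu
  have h := congrArg (fun L => L w) (hD2.unique hD1)
  simp only [ContinuousLinearMap.comp_apply, ContinuousLinearMap.prod_apply, fderivInnerCLM_apply,
    zero_apply, add_apply, ContinuousLinearMap.flip_apply, map_zero, zero_add] at h
  linarith

/-- **Immersion lower bound**: `c ‖u‖ ≤ ‖DK̃(x) u‖` for `u ⊥ x`, with `c > 0`. [folklore] -/
theorem exists_mul_norm_le_norm_dExt (hf : ContMDiff (𝓡 2) (𝓡 4) ∞ f)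
    (hf' : ∀ x, Injective (mfderiv (𝓡 2) (𝓡 4) f x)) (x : 𝕊 2) :
    ∃ c > 0, ∀ u : 𝔼 3, ⟪u, (x : 𝔼 3)⟫ = 0 → c * ‖u‖ ≤ ‖dExt f x u‖ := by
  haveI := Fact.mk (@finrank_euclideanSpace_fin ℝ _ (2 + 1))
  set W : Submodule ℝ (𝔼 3) := (ℝ ∙ (x : 𝔼 3))ᗮ
  let L : W →ₗ[ℝ] 𝔼 5 := (dExt f x).toLinearMap.comp W.subtype
  have hL : LinearMap.ker L = ⊥ := by
    rw [LinearMap.ker_eq_bot]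
    intro a b hab
    have hmem : ⟪((a : 𝔼 3) - b), (x : 𝔼 3)⟫ = 0 :=
      Submodule.mem_orthogonal_singleton_iff_inner_left.1 (W.sub_mem a.2 b.2)
    have h0 : dExt f x ((a : 𝔼 3) - b) = 0 := by
      rw [map_sub, sub_eq_zero]
      exact hab
    exact Subtype.ext (sub_eq_zero.1 (dExt_eq_zero_imp hf hf' x hmem h0))
  obtain ⟨K, -, hK⟩ := L.exists_antilipschitzWith hL
  obtain ⟨c, hc, hcK⟩ := antilipschitzWith_iff_exists_mul_le_norm.1 ⟨K, hK⟩
  refine ⟨c, hc, fun u hu => ?_⟩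
  have hmem : u ∈ W := Submodule.mem_orthogonal_singleton_iff_inner_left.2 hu
  have := hcK ⟨u, hmem⟩
  simpa [L] using this

/-- `⟪x - x', x₀⟫` is small when `x, x'` are points of the unit sphere close to `x₀`: it equals
`⟪x - x', x₀ - (x + x') / 2⟫`. [folklore] -/
theorem abs_inner_sub_le_of_mem_sphere {x x' x₀ : 𝔼 3} (hx : ‖x‖ = 1) (hx' : ‖x'‖ = 1) {ρ : ℝ}
    (h1 : ‖x - x₀‖ < ρ) (h2 : ‖x' - x₀‖ < ρ) : |⟪x - x', x₀⟫| ≤ ρ * ‖x - x'‖ := by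
  have hsum : ⟪x - x', x + x'⟫ = 0 := by
    rw [inner_sub_left, inner_add_right, inner_add_right, real_inner_self_eq_norm_sq,
      real_inner_self_eq_norm_sq, hx, hx', real_inner_comm x x']
    ring
  have heq : ⟪x - x', x₀⟫ = ⟪x - x', x₀ - (2 : ℝ)⁻¹ • (x + x')⟫ := by
    rw [inner_sub_right, inner_smul_right, hsum, mul_zero, sub_zero]
  have hm : ‖x₀ - (2 : ℝ)⁻¹ • (x + x')‖ ≤ ρ := by
    have : x₀ - (2 : ℝ)⁻¹ • (x + x') = (2 : ℝ)⁻¹ • ((x₀ - x) + (x₀ - x')) := by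
      simp only [smul_add, smul_sub]; abel_nf
      module
    rw [this, norm_smul, Real.norm_eq_abs, abs_of_pos (by norm_num : (0 : ℝ) < 2⁻¹)]
    have := norm_add_le (x₀ - x) (x₀ - x')
    rw [norm_sub_rev x₀ x, norm_sub_rev x₀ x'] at this
    linarith
  rw [heq]
  calc |⟪x - x', x₀ - (2 : ℝ)⁻¹ • (x + x')⟫| ≤ ‖x - x'‖ * ‖x₀ - (2 : ℝ)⁻¹ • (x + x')‖ :=
        abs_real_inner_le_norm _ _
    _ ≤ ‖x - x'‖ * ρ := by gcongr
    _ = ρ * ‖x - x'‖ := mul_comm _ _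

/-- **Local uniqueness of the foot of a normal** (the injectivity half of the inverse function
theorem for the normal exponential map, by hand): near a point `x₀` of a smooth immersion
`f : 𝕊² → 𝕊⁴`, a point `z` close to `f x₀` is normal to the tangent planes of `f` at two nearby
points `x, x'` only if `x = x'`. (Key estimate: `0 = ⟪z, (DK̃(x) - DK̃(x'))(x - x')⟫` while the
second-order identity gives `⟪f x₀, D²K̃(x₀)(d) d⟫ = -‖DK̃(x₀) d‖² ≤ -c² ‖d‖² / 4`.)
[cite: HirschDT1976, Ch. 4 §5 Thm. 5.1] -/
theorem exists_local_foot_unique (hf : ContMDiff (𝓡 2) (𝓡 4) ∞ f)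
    (hf' : ∀ x, Injective (mfderiv (𝓡 2) (𝓡 4) f x)) (x₀ : 𝕊 2) :
    ∃ ρ > 0, ∀ x x' : 𝕊 2, ‖(x : 𝔼 3) - x₀‖ < ρ → ‖(x' : 𝔼 3) - x₀‖ < ρ → ∀ z : 𝔼 5,
      ‖z - f x₀‖ < ρ → (∀ u, ⟪z, dExt f x u⟫ = 0) → (∀ u, ⟪z, dExt f x' u⟫ = 0) → x = x' := by
  have hfE := contMDiff_coe_comp hf
  have hx0 : (x₀ : 𝔼 3) ≠ 0 := ne_zero_of_mem_unit_sphere x₀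
  set G : 𝔼 3 → 𝔼 3 →L[ℝ] 𝔼 5 := fun t => fderiv ℝ (extF f) t with hG
  -- (1) immersion lower bound
  obtain ⟨c, hc, hcb⟩ := exists_mul_norm_le_norm_dExt hf hf' x₀
  -- (2) `G` is Lipschitz near `x₀`
  have hGsmooth : ContDiffAt ℝ ∞ G x₀ := contDiffAt_fderiv_sphExt hfE hx0
  obtain ⟨L, t, ht, hL⟩ := (hGsmooth.of_le (by exact_mod_cast le_top)).exists_lipschitzOnWith
  obtain ⟨δ₂, hδ₂, hball⟩ := Metric.mem_nhds_iff.1 ht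
  -- (3) strict differentiability of `G` at `x₀`, with `η = c² / 16`
  set G' := fderiv ℝ G x₀ with hG'
  have hstrict : HasStrictFDerivAt G G' x₀ := hGsmooth.hasStrictFDerivAt (by simp)
  have hη : (0 : ℝ) < c ^ 2 / 16 := by positivity
  obtain ⟨δ₁, hδ₁, hlo⟩ := Metric.eventually_nhds_iff.1 (hstrict.isLittleO.def hη)
  -- (4) the radius
  set ρ : ℝ := min (min δ₁ δ₂) (min (1 / 2) (c ^ 2 / (16 * (L + 1)))) with hρ
  have hρpos : 0 < ρ := by
    simp only [hρ, lt_min_iff]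
    exact ⟨⟨hδ₁, hδ₂⟩, by norm_num, by positivity⟩
  have hρ₁ : ρ ≤ δ₁ := (min_le_left _ _).trans (min_le_left _ _)
  have hρ₂ : ρ ≤ δ₂ := (min_le_left _ _).trans (min_le_right _ _)
  have hρh : ρ ≤ 1 / 2 := (min_le_right _ _).trans (min_le_left _ _)
  have hρL : ρ * L ≤ c ^ 2 / 16 := by
    have h1 : ρ ≤ c ^ 2 / (16 * (L + 1)) := (min_le_right _ _).trans (min_le_right _ _)
    have hL0 : (0 : ℝ) ≤ L := L.coe_nonneg
    calc ρ * L ≤ c ^ 2 / (16 * (L + 1)) * L := by gcongr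
      _ ≤ c ^ 2 / (16 * (L + 1)) * (L + 1) := by gcongr; linarith
      _ = c ^ 2 / 16 := by field_simp
  refine ⟨ρ, hρpos, fun x x' hx hx' z hz hn hn' => ?_⟩
  -- (5) the estimate
  by_contra hne
  set d : 𝔼 3 := (x : 𝔼 3) - x' with hd
  have hd0 : d ≠ 0 := fun h => hne (Subtype.ext (sub_eq_zero.1 h))
  have hdpos : 0 < ‖d‖ := norm_pos_iff.2 hd0
  have hxt : (x : 𝔼 3) ∈ t := hball (mem_ball_iff_norm.2 (hx.trans_le hρ₂))
  have hxt' : (x' : 𝔼 3) ∈ t := hball (mem_ball_iff_norm.2 (hx'.trans_le hρ₂))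
  set A : 𝔼 3 →L[ℝ] 𝔼 5 := G x - G x' with hA
  set R : 𝔼 3 →L[ℝ] 𝔼 5 := A - G' d with hR
  -- `z` is normal at `x` and at `x'`
  have h0 : ⟪z, A d⟫ = 0 := by
    rw [hA, sub_apply, inner_sub_right]
    change ⟪z, dExt f x d⟫ - ⟪z, dExt f x' d⟫ = 0
    rw [hn d, hn' d, sub_zero]
  -- the remainder of the strict derivative
  have hRle : ‖R‖ ≤ c ^ 2 / 16 * ‖d‖ := by
    have := hlo (y := ((x : 𝔼 3), (x' : 𝔼 3))) (by
      rw [Prod.dist_eq, dist_eq_norm, dist_eq_norm]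
      exact max_lt (hx.trans_le hρ₁) (hx'.trans_le hρ₁))
    simpa [hR, hA, hd] using this
  -- the Lipschitz bound
  have hAle : ‖A‖ ≤ L * ‖d‖ := hL.norm_sub_le hxt hxt'
  -- splitting `⟪z, A d⟫`
  have hsplit : ⟪z, A d⟫ = ⟪(f x₀ : 𝔼 5), (G' d) d⟫ + ⟪(f x₀ : 𝔼 5), R d⟫ + ⟪z - f x₀, A d⟫ := by
    have h1 : A d = (G' d) d + R d := by
      simp only [hR, sub_apply]; abel
    have h2 : ⟪(f x₀ : 𝔼 5), A d⟫ = ⟪(f x₀ : 𝔼 5), (G' d) d⟫ + ⟪(f x₀ : 𝔼 5), R d⟫ := by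
      rw [h1, inner_add_right]
    rw [← h2, ← inner_add_left, add_sub_cancel]
  -- the second-order identity at `x₀`
  have h2nd : ⟪(f x₀ : 𝔼 5), (G' d) d⟫ = -‖G x₀ d‖ ^ 2 := by
    have := inner_fderiv_fderiv_add_inner_extF hf hx0 d d
    rw [real_inner_self_eq_norm_sq] at this
    have hx₀ : extF f (x₀ : 𝔼 3) = f x₀ := sphExt_coe _ x₀
    rw [hx₀] at this
    linarith
  -- bounds on the error terms
  have hb1 : |⟪(f x₀ : 𝔼 5), R d⟫| ≤ c ^ 2 / 16 * ‖d‖ ^ 2 :=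
    calc |⟪(f x₀ : 𝔼 5), R d⟫| ≤ ‖(f x₀ : 𝔼 5)‖ * ‖R d‖ := abs_real_inner_le_norm _ _
      _ = ‖R d‖ := by rw [norm_eq_of_mem_sphere, one_mul]
      _ ≤ ‖R‖ * ‖d‖ := R.le_opNorm d
      _ ≤ c ^ 2 / 16 * ‖d‖ * ‖d‖ := by gcongr
      _ = c ^ 2 / 16 * ‖d‖ ^ 2 := by ring
  have hb2 : |⟪z - f x₀, A d⟫| ≤ c ^ 2 / 16 * ‖d‖ ^ 2 :=
    calc |⟪z - f x₀, A d⟫| ≤ ‖z - f x₀‖ * ‖A d‖ := abs_real_inner_le_norm _ _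
      _ ≤ ρ * (‖A‖ * ‖d‖) := by gcongr; exact A.le_opNorm d
      _ ≤ ρ * (L * ‖d‖ * ‖d‖) := by gcongr
      _ = ρ * L * ‖d‖ ^ 2 := by ring
      _ ≤ c ^ 2 / 16 * ‖d‖ ^ 2 := by gcongr
  -- lower bound for `‖G x₀ d‖`
  have hlow : c / 2 * ‖d‖ ≤ ‖G x₀ d‖ := by
    set d' : 𝔼 3 := d - ⟪d, (x₀ : 𝔼 3)⟫ • (x₀ : 𝔼 3) with hd'
    have hx₀1 : ‖(x₀ : 𝔼 3)‖ = 1 := norm_eq_of_mem_sphere x₀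
    have hperp : ⟪d', (x₀ : 𝔼 3)⟫ = 0 := by
      rw [hd', inner_sub_left, inner_smul_left, real_inner_self_eq_norm_sq, hx₀1]
      simp
    have hGx₀ : G x₀ (x₀ : 𝔼 3) = 0 := dExt_apply_self hf x₀
    have hGd : G x₀ d' = G x₀ d := by
      simp only [hd', map_sub, map_smul, hGx₀, smul_zero, sub_zero]
    have hsmall : |⟪d, (x₀ : 𝔼 3)⟫| ≤ ρ * ‖d‖ :=
      abs_inner_sub_le_of_mem_sphere (norm_eq_of_mem_sphere x) (norm_eq_of_mem_sphere x') hx hx'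
    have hd'ge : ‖d‖ / 2 ≤ ‖d'‖ := by
      have h1 : ‖d‖ - ‖⟪d, (x₀ : 𝔼 3)⟫ • (x₀ : 𝔼 3)‖ ≤ ‖d'‖ := norm_sub_norm_le _ _
      rw [norm_smul, hx₀1, mul_one, Real.norm_eq_abs] at h1
      nlinarith
    calc c / 2 * ‖d‖ = c * (‖d‖ / 2) := by ring
      _ ≤ c * ‖d'‖ := by gcongr
      _ ≤ ‖dExt f x₀ d'‖ := hcb d' hperp
      _ = ‖G x₀ d‖ := by rw [← hGd]; rfl
  -- conclusion
  have hkey : ‖G x₀ d‖ ^ 2 ≤ c ^ 2 / 8 * ‖d‖ ^ 2 := by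
    have := hsplit
    rw [h0, h2nd] at this
    have e1 := (abs_le.1 hb1).2
    have e2 := (abs_le.1 hb2).2
    linarith
  have hlow2 : c ^ 2 / 4 * ‖d‖ ^ 2 ≤ ‖G x₀ d‖ ^ 2 := by
    have hcd : 0 ≤ c / 2 * ‖d‖ := by positivity
    calc c ^ 2 / 4 * ‖d‖ ^ 2 = (c / 2 * ‖d‖) ^ 2 := by ring
      _ ≤ ‖G x₀ d‖ ^ 2 := pow_le_pow_left₀ hcd hlow 2
  have hpos : 0 < c ^ 2 * ‖d‖ ^ 2 := by positivity
  linarith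

/-- **Injectivity radius of the normal tube**: for a smooth embedding `f : 𝕊² → 𝕊⁴` there is
`ε > 0` such that a point `z ∈ ℝ⁵` within `ε` of two image points `f x, f x'` and normal to both
tangent planes has `x = x'` (compactness upgrade of `exists_local_foot_unique`).
[cite: HirschDT1976, Ch. 4 §5 Thm. 5.1] -/
theorem exists_injRadius (hf : ContMDiff (𝓡 2) (𝓡 4) ∞ f)
    (hf' : ∀ x, Injective (mfderiv (𝓡 2) (𝓡 4) f x)) (hinj : Injective f) :
    ∃ ε > 0, ∀ x x' : 𝕊 2, ∀ z : 𝔼 5, (∀ u, ⟪z, dExt f x u⟫ = 0) → (∀ u, ⟪z, dExt f x' u⟫ = 0) →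
      ‖z - f x‖ ≤ ε → ‖z - f x'‖ ≤ ε → x = x' := by
  haveI := Fact.mk (@finrank_euclideanSpace_fin ℝ _ (4 + 1))
  by_contra! H
  choose xs xs' zs hN hN' hz hz' hne using fun n : ℕ => H (1 / ((n : ℝ) + 1)) (by positivity)
  have hcont : Continuous fun x : 𝕊 2 => (f x : 𝔼 5) := (contMDiff_coe_comp hf).continuous
  -- a convergent subsequence
  have hK : IsCompact ((univ : Set (𝕊 2)) ×ˢ ((univ : Set (𝕊 2)) ×ˢ closedBall (0 : 𝔼 5) 2)) :=
    isCompact_univ.prod (isCompact_univ.prod (isCompact_closedBall 0 2))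
  have hmem : ∀ n, (xs n, xs' n, zs n) ∈ (univ : Set (𝕊 2)) ×ˢ ((univ : Set (𝕊 2)) ×ˢ
      closedBall (0 : 𝔼 5) 2) := by
    intro n
    refine ⟨mem_univ _, mem_univ _, mem_closedBall_zero_iff.2 ?_⟩
    have h1 : (1 : ℝ) / (n + 1) ≤ 1 := by
      rw [div_le_one (by positivity)]; linarith [n.cast_nonneg (α := ℝ)]
    calc ‖zs n‖ = ‖(zs n - f (xs n)) + (f (xs n) : 𝔼 5)‖ := by rw [sub_add_cancel]
      _ ≤ ‖zs n - f (xs n)‖ + ‖(f (xs n) : 𝔼 5)‖ := norm_add_le _ _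
      _ ≤ 1 + 1 := add_le_add ((hz n).trans h1) (norm_eq_of_mem_sphere (f (xs n))).le
      _ = 2 := by norm_num
  obtain ⟨⟨x₀, x₀', z₀⟩, -, φ, hφ, hlim⟩ := hK.tendsto_subseq hmem
  have hx : Tendsto (fun n => xs (φ n)) atTop (𝓝 x₀) := (continuous_fst.tendsto _).comp hlim
  have hx' : Tendsto (fun n => xs' (φ n)) atTop (𝓝 x₀') :=
    ((continuous_fst.comp continuous_snd).tendsto _).comp hlim
  have hzl : Tendsto (fun n => zs (φ n)) atTop (𝓝 z₀) :=
    ((continuous_snd.comp continuous_snd).tendsto _).comp hlim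
  -- `1 / (φ n + 1) → 0`
  have hsmall : Tendsto (fun n => (1 : ℝ) / ((φ n : ℝ) + 1)) atTop (𝓝 0) :=
    (tendsto_one_div_add_atTop_nhds_zero_nat (𝕜 := ℝ)).comp hφ.tendsto_atTop
  -- hence `z₀ = f x₀ = f x₀'`
  have hlim0 : ∀ {ys : ℕ → 𝕊 2} {y : 𝕊 2}, Tendsto (fun n => ys (φ n)) atTop (𝓝 y) →
      (∀ n, ‖zs n - f (ys n)‖ ≤ 1 / ((n : ℝ) + 1)) → z₀ = f y := by
    intro ys y hy hb
    have h1 : Tendsto (fun n => ‖zs (φ n) - (f (ys (φ n)) : 𝔼 5)‖) atTop (𝓝 ‖z₀ - f y‖) :=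
      (hzl.sub ((hcont.tendsto y).comp hy)).norm
    have h2 : Tendsto (fun n => ‖zs (φ n) - (f (ys (φ n)) : 𝔼 5)‖) atTop (𝓝 0) :=
      squeeze_zero (fun n => norm_nonneg _) (fun n => hb (φ n)) hsmall
    have := tendsto_nhds_unique h1 h2
    exact sub_eq_zero.1 (norm_eq_zero.1 this)
  have h₀ : z₀ = f x₀ := hlim0 hx hz
  have h₀' : z₀ = f x₀' := hlim0 hx' hz'
  have hxx : x₀ = x₀' := hinj (Subtype.ext (h₀.symm.trans h₀'))
  -- the local lemma at `x₀`
  obtain ⟨ρ, hρ, hloc⟩ := exists_local_foot_unique hf hf' x₀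
  have hcoe : Continuous fun x : 𝕊 2 => (x : 𝔼 3) := continuous_subtype_val
  have e1 : ∀ᶠ n in atTop, ‖(xs (φ n) : 𝔼 3) - x₀‖ < ρ := by
    have := (hcoe.tendsto x₀).comp hx
    rw [tendsto_iff_norm_sub_tendsto_zero] at this
    exact this.eventually (gt_mem_nhds hρ)
  have e2 : ∀ᶠ n in atTop, ‖(xs' (φ n) : 𝔼 3) - x₀‖ < ρ := by
    have := (hcoe.tendsto x₀').comp hx'
    rw [tendsto_iff_norm_sub_tendsto_zero, ← hxx] at this
    exact this.eventually (gt_mem_nhds hρ)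
  have e3 : ∀ᶠ n in atTop, ‖zs (φ n) - f x₀‖ < ρ := by
    have := hzl
    rw [tendsto_iff_norm_sub_tendsto_zero, h₀] at this
    exact this.eventually (gt_mem_nhds hρ)
  obtain ⟨n, hn1, hn2, hn3⟩ := (e1.and (e2.and e3)).exists
  exact hne (φ n) (hloc _ _ hn1 hn2 _ hn3 (hN (φ n)) (hN' (φ n)))

/-! ### Nearest points are feet of normals -/

/-- **A nearest image point is the foot of a normal**: if `x₀` minimises `‖z - f x‖` then `z` is
orthogonal to the tangent plane `df(T_{x₀} 𝕊²)` (first-order condition along the curves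
`t ↦ K̃(x₀ + t u)`). [folklore] -/
theorem forall_inner_dExt_eq_zero_of_isMinOn (hf : ContMDiff (𝓡 2) (𝓡 4) ∞ f) (x₀ : 𝕊 2)
    (z : 𝔼 5) (hmin : ∀ x : 𝕊 2, ‖z - f x₀‖ ≤ ‖z - f x‖) (u : 𝔼 3) : ⟪z, dExt f x₀ u⟫ = 0 := by
  have hfE := contMDiff_coe_comp hf
  have hx0 : (x₀ : 𝔼 3) ≠ 0 := ne_zero_of_mem_unit_sphere x₀
  set φ : ℝ → ℝ := fun t => ‖z - extF f ((x₀ : 𝔼 3) + t • u)‖ ^ 2 with hφ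
  have hloc : IsLocalMin φ 0 := by
    refine Filter.Eventually.of_forall fun t => ?_
    obtain ⟨x, hx⟩ := extF_mem_range (f := f) ((x₀ : 𝔼 3) + t • u)
    simp only [hφ, zero_smul, add_zero, extF, sphExt_coe]
    change ‖z - (f x₀ : 𝔼 5)‖ ^ 2 ≤ ‖z - extF f ((x₀ : 𝔼 3) + t • u)‖ ^ 2
    rw [← hx]
    gcongr
    exact hmin x
  have hcurve : HasDerivAt (fun t : ℝ => (x₀ : 𝔼 3) + t • u) u 0 := by
    simpa using ((hasDerivAt_id (0 : ℝ)).smul_const u).const_add (x₀ : 𝔼 3)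
  have hK : HasFDerivAt (extF f) (fderiv ℝ (extF f) (x₀ : 𝔼 3)) ((x₀ : 𝔼 3) + (0 : ℝ) • u) := by
    rw [zero_smul, add_zero]; exact hasFDerivAt_sphExt hfE hx0
  have hcomp : HasDerivAt (fun t : ℝ => z - extF f ((x₀ : 𝔼 3) + t • u))
      (-(fderiv ℝ (extF f) (x₀ : 𝔼 3) u)) 0 := by
    simpa using (hK.comp_hasDerivAt (0 : ℝ) hcurve).const_sub z
  have hd : HasDerivAt φ (2 * ⟪z - extF f ((x₀ : 𝔼 3) + (0 : ℝ) • u),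
      -(fderiv ℝ (extF f) (x₀ : 𝔼 3) u)⟫) 0 := hcomp.norm_sq
  have h := hloc.hasDerivAt_eq_zero hd
  have h' : ⟪z - (f x₀ : 𝔼 5), fderiv ℝ (extF f) (x₀ : 𝔼 3) u⟫ = 0 := by
    simp only [zero_smul, add_zero, extF, sphExt_coe, inner_neg_right] at h
    linarith
  have h3 : ⟪(f x₀ : 𝔼 5), dExt f x₀ u⟫ = 0 := by
    rw [real_inner_comm]; exact inner_dExt_coe hf x₀ u
  rw [inner_sub_left] at h'
  change ⟪z, dExt f x₀ u⟫ - ⟪(f x₀ : 𝔼 5), dExt f x₀ u⟫ = 0 at h'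
  linarith

/-- A point of `ℝ⁵` has a nearest point on the (compact) image `f(𝕊²)`. [folklore] -/
theorem exists_forall_norm_sub_le (hcont : Continuous f) (z : 𝔼 5) :
    ∃ x₀ : 𝕊 2, ∀ x : 𝕊 2, ‖z - f x₀‖ ≤ ‖z - f x‖ := by
  have hc : Continuous fun x : 𝕊 2 => ‖z - (f x : 𝔼 5)‖ :=
    (continuous_const.sub (continuous_subtype_val.comp hcont)).norm
  obtain ⟨x₀, -, hx₀⟩ := isCompact_univ.exists_isMinOn ⟨spherePt 2, mem_univ _⟩ hc.continuousOn
  exact ⟨x₀, fun x => hx₀ (mem_univ x)⟩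

/-- **A nearest image point** `nearPt f z ∈ 𝕊²` of `z ∈ ℝ⁵`: some minimiser of `x ↦ ‖z - f x‖`
(a `Classical.epsilon` choice; for continuous `f` a minimiser exists, `norm_sub_nearPt_le`).
[folklore] -/
def nearPt (f : 𝕊 2 → 𝕊 4) (z : 𝔼 5) : 𝕊 2 :=
  @Classical.epsilon (𝕊 2) ⟨spherePt 2⟩ fun x₀ => ∀ x : 𝕊 2, ‖z - f x₀‖ ≤ ‖z - f x‖

/-- The nearest point minimises the distance. [folklore] -/
theorem norm_sub_nearPt_le (hcont : Continuous f) (z : 𝔼 5) (x : 𝕊 2) :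
    ‖z - f (nearPt f z)‖ ≤ ‖z - f x‖ :=
  Classical.epsilon_spec (p := fun x₀ : 𝕊 2 => ∀ x : 𝕊 2, ‖z - f x₀‖ ≤ ‖z - f x‖)
    (exists_forall_norm_sub_le hcont z) x

/-- The distance to the nearest point is the distance to the image. [folklore] -/
theorem norm_sub_nearPt (hcont : Continuous f) (z : 𝔼 5) :
    ‖z - f (nearPt f z)‖ = infDist z (range fun x : 𝕊 2 => (f x : 𝔼 5)) := by
  have hcpt : IsCompact (range fun x : 𝕊 2 => (f x : 𝔼 5)) :=
    isCompact_range (continuous_subtype_val.comp hcont)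
  obtain ⟨_, ⟨x₁, rfl⟩, h⟩ := hcpt.exists_infDist_eq_dist (range_nonempty _) z
  refine le_antisymm ?_ ?_
  · rw [h, dist_eq_norm]
    exact norm_sub_nearPt_le hcont z x₁
  · rw [← dist_eq_norm]
    exact infDist_le_dist_of_mem ⟨_, rfl⟩

/-- `z` is normal to `f` at its nearest point. [folklore] -/
theorem inner_dExt_nearPt (hf : ContMDiff (𝓡 2) (𝓡 4) ∞ f) (z : 𝔼 5) (u : 𝔼 3) :
    ⟪z, dExt f (nearPt f z) u⟫ = 0 :=
  forall_inner_dExt_eq_zero_of_isMinOn hf _ z (norm_sub_nearPt_le hf.continuous z) u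

/-! ### The tube of radius `r` and the continuity of the nearest-point map -/

variable (f) in
/-- `IsInjRadius f ε`: two feet of normals from a point within `ε` of both coincide (the
conclusion of `exists_injRadius`). [folklore] -/
def IsInjRadius (ε : ℝ) : Prop :=
  ∀ ⦃x x' : 𝕊 2⦄ ⦃z : 𝔼 5⦄, (∀ u, ⟪z, dExt f x u⟫ = 0) → (∀ u, ⟪z, dExt f x' u⟫ = 0) →
    ‖z - f x‖ ≤ ε → ‖z - f x'‖ ≤ ε → x = x'

/-- A smooth embedding `𝕊² → 𝕊⁴` has a positive injectivity radius. [folklore] -/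
theorem exists_isInjRadius (hf : ContMDiff (𝓡 2) (𝓡 4) ∞ f)
    (hf' : ∀ x, Injective (mfderiv (𝓡 2) (𝓡 4) f x)) (hinj : Injective f) :
    ∃ ε > 0, IsInjRadius f ε := by
  obtain ⟨ε, hε, h⟩ := exists_injRadius hf hf' hinj
  exact ⟨ε, hε, fun x x' z h1 h2 h3 h4 => h x x' z h1 h2 h3 h4⟩

/-- An injectivity radius can be decreased. [folklore] -/
theorem IsInjRadius.mono {ε ε' : ℝ} (h : IsInjRadius f ε) (hle : ε' ≤ ε) : IsInjRadius f ε' :=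
  fun _ _ _ h1 h2 h3 h4 => h h1 h2 (h3.trans hle) (h4.trans hle)

/-- Within the injectivity radius, **the foot of a normal is the nearest point**. [folklore] -/
theorem IsInjRadius.eq_nearPt {ε : ℝ} (hε : IsInjRadius f ε) (hf : ContMDiff (𝓡 2) (𝓡 4) ∞ f)
    {x : 𝕊 2} {z : 𝔼 5} (hn : ∀ u, ⟪z, dExt f x u⟫ = 0) (hz : ‖z - f x‖ ≤ ε) :
    x = nearPt f z :=
  hε hn (inner_dExt_nearPt hf z) hz ((norm_sub_nearPt_le hf.continuous z x).trans hz)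

/-- The nearest point of an image point is its (unique) preimage. [folklore] -/
theorem IsInjRadius.nearPt_coe {ε : ℝ} (hε : IsInjRadius f ε) (hε0 : 0 ≤ ε)
    (hf : ContMDiff (𝓡 2) (𝓡 4) ∞ f) (x : 𝕊 2) : nearPt f (f x) = x :=
  (hε.eq_nearPt hf (fun u => by rw [real_inner_comm]; exact inner_dExt_coe hf x u)
    (by simpa using hε0)).symm

/-- **Continuity of the nearest-point map on the tube** `{z | infDist z f(𝕊²) ≤ ε}` within the
injectivity radius: it is the inverse of the continuous bijection `(x, z) ↦ z` from the compact set
of pairs (foot, point of the normal `3`-space within `ε`) onto the tube. [folklore] -/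
theorem IsInjRadius.continuousOn_nearPt {ε : ℝ} (hε : IsInjRadius f ε)
    (hf : ContMDiff (𝓡 2) (𝓡 4) ∞ f) :
    ContinuousOn (nearPt f) {z | infDist z (range fun x : 𝕊 2 => (f x : 𝔼 5)) ≤ ε} := by
  haveI := Fact.mk (@finrank_euclideanSpace_fin ℝ _ (2 + 1))
  have hfE := contMDiff_coe_comp hf
  have hcont : Continuous fun x : 𝕊 2 => (f x : 𝔼 5) := hfE.continuous
  set Sf := range fun x : 𝕊 2 => (f x : 𝔼 5) with hSf
  set A : Set (𝔼 5) := {z | infDist z Sf ≤ ε} with hA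
  set C : Set (𝕊 2 × 𝔼 5) := {p | (∀ u, ⟪p.2, dExt f p.1 u⟫ = 0) ∧ ‖p.2 - f p.1‖ ≤ ε} with hC
  -- `C` is compact
  have hCc : IsClosed C := by
    have h1 : IsClosed {p : 𝕊 2 × 𝔼 5 | ∀ u, ⟪p.2, dExt f p.1 u⟫ = 0} := by
      rw [show {p : 𝕊 2 × 𝔼 5 | ∀ u, ⟪p.2, dExt f p.1 u⟫ = 0} =
        ⋂ u, {p : 𝕊 2 × 𝔼 5 | ⟪p.2, dExt f p.1 u⟫ = 0} by ext p; simp]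
      refine isClosed_iInter fun u => isClosed_eq ?_ continuous_const
      exact continuous_snd.inner
        (((contMDiff_fderiv_sphExt hfE).continuous.clm_apply continuous_const).comp continuous_fst)
    have h2 : IsClosed {p : 𝕊 2 × 𝔼 5 | ‖p.2 - f p.1‖ ≤ ε} :=
      isClosed_le (continuous_snd.sub (hcont.comp continuous_fst)).norm continuous_const
    exact h1.inter h2
  have hCK : IsCompact C := by
    refine (isCompact_univ.prod (isCompact_closedBall (0 : 𝔼 5) (ε + 1))).of_isClosed_subset hCc ?_
    rintro ⟨x, z⟩ ⟨-, hz⟩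
    refine ⟨mem_univ _, mem_closedBall_zero_iff.2 ?_⟩
    calc ‖z‖ = ‖(z - f x) + (f x : 𝔼 5)‖ := by rw [sub_add_cancel]
      _ ≤ ‖z - f x‖ + ‖(f x : 𝔼 5)‖ := norm_add_le _ _
      _ ≤ ε + 1 := add_le_add hz (norm_eq_of_mem_sphere (f x)).le
  haveI : CompactSpace C := isCompact_iff_compactSpace.1 hCK
  -- the projection `C → A`
  have hmapsto : ∀ p : C, (p : 𝕊 2 × 𝔼 5).2 ∈ A := by
    rintro ⟨⟨x, z⟩, -, hz⟩
    have hmem : (f x : 𝔼 5) ∈ Sf := ⟨x, rfl⟩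
    have h1 : infDist z Sf ≤ dist z (f x : 𝔼 5) := infDist_le_dist_of_mem hmem
    rw [dist_eq_norm] at h1
    exact h1.trans hz
  let Φ : C → A := fun p => ⟨(p : 𝕊 2 × 𝔼 5).2, hmapsto p⟩
  have hΦc : Continuous Φ := (continuous_snd.comp continuous_subtype_val).subtype_mk _
  have hΦi : Injective Φ := by
    rintro ⟨⟨x, z⟩, hn, hz⟩ ⟨⟨x', z'⟩, hn', hz'⟩ h
    have hzz : z = z' := congrArg Subtype.val h
    subst hzz
    have hxx : x = x' := hε hn hn' hz hz'
    subst hxx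
    rfl
  have hΦs : Surjective Φ := by
    rintro ⟨z, hz⟩
    refine ⟨⟨(nearPt f z, z), fun u => inner_dExt_nearPt hf z u, ?_⟩, rfl⟩
    change ‖z - f (nearPt f z)‖ ≤ ε
    rwa [norm_sub_nearPt hf.continuous]
  let Ψ : C ≃ₜ A := Continuous.homeoOfEquivCompactToT2 (f := Equiv.ofBijective Φ ⟨hΦi, hΦs⟩) hΦc
  -- `nearPt` agrees with the inverse on `A`
  have hagree : ∀ a : A, nearPt f (a : 𝔼 5) = ((Ψ.symm a : C) : 𝕊 2 × 𝔼 5).1 := by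
    intro a
    set p := Ψ.symm a with hp
    have hpa : Φ p = a := by
      have := Ψ.apply_symm_apply a
      rwa [hp]
    obtain ⟨⟨x, z⟩, hn, hz⟩ := p
    have hza : z = (a : 𝔼 5) := congrArg Subtype.val hpa
    subst hza
    exact (hε.eq_nearPt hf hn hz).symm
  rw [continuousOn_iff_continuous_restrict]
  have : A.restrict (nearPt f) = fun a : A => ((Ψ.symm a : C) : 𝕊 2 × 𝔼 5).1 := funext hagree
  rw [this]
  exact continuous_fst.comp (continuous_subtype_val.comp Ψ.symm.continuous)

end Tube

end TwoKnotNormalSection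

end Literature.Topology.FourManifolds
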